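import Literature.AnabelianGeometry.EtaleTheta.SettingModelTateDeckIterates
import HarnessLib

/-!
# The stage-2 («Tate shear») model of [EtTh] §1: the typed Prop. 1.5 (iii) on the TWIST FAMILY
# `η_m := η̈♯ · infl(log Ü)^m` holds EXACTLY on `{j = 2, m = i − 1}` (proof-only; census)

S. Mochizuki, *The étale theta function and its Frobenioid-theoretic manifestations*, Publ. RIMS **45** (2009) [EtTh], §1,
Prop. 1.5 (iii), PRIMS PDF p. 23 (printed 249): «Any class η̈^Θ ∈ H¹(Π^tp_Ÿ, Δ_Θ) arises from a unique class η̈^Θ ∈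
H¹((Π^tp_Ÿ)^Θ, Δ_Θ) that maps to log(Θ) in the quotient F̈⁰/F̈¹ and on which a ∈ Z acts as follows: η̈^Θ ↦ η̈^Θ − 2a·log(Ü) −
(a²/2)·log(q_X) + log(O^×_K̈)» [cite: MochizukiEtTh2009, Prop 1.5 (iii) p.23].  abc-iut cell, layer L2, seat abc-iut-L2-t12
(gen 11); row «TWIST-FAMILY@stage-2», file (B) of three (file (A) = `SettingModelTateDeckIterates`).  PROOF-ONLY: no definition,
no instance, no `Prop` fact; everything BY NAME — this lineage's generator reduction
`KummerCore.prop15iii_etaleThetaDataOfClass_ofSection_of_generator` (gen 5) and lift uniqueness `ThetaSetting.inflTheta_injective`,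
abc-iut-L2-t6's `conj_deckGen_logUdd` / `unitLaw_GtpY_logUdd` / `unitLaw_GtpY_zClassYddχq` / `res_zClassYddχq_eq_logTheta` /
`kumYdd_toKddHat_ofSection_modelχq` / `prop15iiQuot_ofSection_modelχq` (junction `Prop15iiQuot.logUdd_mem_Fdd1`), this seat's
gen-6 `not_prop15iii_modelχq_of_ne_two` (`j ≠ 2 ⇒ ¬Prop15iii` for EVERY class) and `qddUnit_zpow_mem_unitsOKdd_iff`, and file
(A)'s `conj_toTheta_zpow_deckGen_twistLift`.

THE RECORD so far: `prop15iii_etaDdχq_iff` (gen 6: the UNtwisted class `m = 0` satisfies the typed Prop. 1.5 (iii) iff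
`(i, j) = (1, 2)`), p501580 (gen 10: the single twist `m = 1` satisfies it at `(2, 2)`).  THIS FILE (numbers, not a side) — for
every `p`, every `i`, every even `j`, every `m ∈ ℤ`, every Galois section `s`, every `Compat` witness:
* `prop15iii_etaDdTwistPow_line` — at `modelχq p i 2` the class `η_{i−1} = η̈♯ · infl(log Ü)^{i−1}` SATISFIES the typed Prop. 1.5 (iii)
  (lift `x′·log(Ü)^{i−1}`, `res = log(Θ)`, deck display `σ₀·x_{i−1} = x_{i−1}·log(Ü)^{−2}·κ̈(q̈)^{−1}`, unit-moves `u₁·u₂^{i−1}`);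
* `twistPow_eq_of_prop15iii_line` — at `modelχq p i 2`, `Prop15iii(E_s(η_m)) ⇒ m = i − 1` (the typed display at `σ₀` pins
  `q̈^{m − i + 1} ∈ O^×_K̈`);
* **`prop15iii_etaDdTwistPow_iff`** — at `modelχq p i j`: `Prop15iii(E_s(η_m)) ↔ j = 2 ∧ m = i − 1`;
* `exists_twistPow_prop15iii_iff` — some member of the twist family satisfies it `↔ j = 2`; root census form
  `prop15iii_etaDdTwistPow_inr_iff`.
HONEST FRAMING: SEMI-SYNTHETIC model — consistency / sharpness evidence for the typed interface ONLY; the twist family is a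
device of this cell, not an object of print; [EtTh] is refereed and nothing of it is disputed or asserted; typed ≠ proved;
inhabited-at-a-model ≠ proved; no side taken on [IUTchIII] Cor. 3.12.
-/

noncomputable section

namespace Literature.AnabelianGeometry.EtaleTheta.SettingModel

open Literature.AnabelianGeometry.SemiGraphs

variable (p : ℕ) [Fact p.Prime] (i j : ℤ) (hj : Even j)

/-- Commutative-group bookkeeping for the unit-moves of the twisted lift. [folklore] -/
private theorem twistPow_unit_algebra {M : Type*} [CommGroup M] (z L u₁ u₂ : M) (m : ℤ) :
    z * u₁ * (L * u₂) ^ m = z * L ^ m * (u₁ * u₂ ^ m) := by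
  apply Additive.ofMul.injective
  simp only [ofMul_mul, ofMul_zpow]
  module

section OfSection

variable (s : GQp p →* (ThetaSetting.modelχq p i j hj).PiTemp) (hs : Continuous s)
  (hsec : ∀ σ : GQp p, (ThetaSetting.modelχq p i j hj).aug (s σ) = σ)
  (hsY : (ThetaSetting.modelχq p i j hj).GK.map s ≤ (ThetaSetting.modelχq p i j hj).GtpY)
  (hsYdd : (ThetaSetting.modelχq p i j hj).GKdd.map s ≤ (ThetaSetting.modelχq p i j hj).GtpYdd)

include s hs hsec hsY hsYdd in
/-- **`res(log Ü) = 1` on `Δ_Θ`** at `modelχq p i j` (every `i`, even `j`): `log(Ü) ∈ F̈¹`, via the Prop. 1.5 (ii)-Quot junction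
through the section datum of `s` (p501580 recorded the `(2, 2)` case). [cite: MochizukiEtTh2009, Prop 1.5 (ii) p.23] -/
theorem res_deltaTheta_logUdd_kummerCoreχq (hC : (ThetaSetting.modelχq p i j hj).Compat) :
    ContH1.res (MonoidHom.id (ThetaSetting.modelχq p i j hj).GtpTheta) (ThetaSetting.modelχq p i j hj).DeltaTheta
        (hC.deltaTheta_le_DtpYddTheta.trans (Subgroup.map_mono inf_le_left)) (kummerCoreχq p i j hj).logUdd = 1 :=
  MonoidHom.mem_ker.mp (prop15iiQuot_ofSection_modelχq s hs hsec hsY hsYdd hC).logUdd_mem_Fdd1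

end OfSection

section LineTwo

variable (s : GQp p →* (ThetaSetting.modelχq p i 2 even_two).PiTemp) (hs : Continuous s)
  (hsec : ∀ σ : GQp p, (ThetaSetting.modelχq p i 2 even_two).aug (s σ) = σ)
  (hsY : (ThetaSetting.modelχq p i 2 even_two).GK.map s ≤ (ThetaSetting.modelχq p i 2 even_two).GtpY)
  (hsYdd : (ThetaSetting.modelχq p i 2 even_two).GKdd.map s ≤ (ThetaSetting.modelχq p i 2 even_two).GtpYdd)

/-- **[EtTh] Prop. 1.5 (iii) HOLDS at `modelχq p i 2` (every `i`) for the TWISTED class `η_{i−1} = η̈♯ · infl(log Ü)^{i−1}`** over the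
section Kummer datum of any Galois section `s`: lift `x_{i−1} = x′·log(Ü)^{i−1}` (`res = log(Θ)` as `res(log Ü) = 1`), deck display
`σ₀·x_{i−1} = x_{i−1}·log(Ü)^{−2}·κ̈(q̈)^{−1}` (file (A), `n = 1`, `m = i − 1`), `Π^tp_Y` unit-moves `u₁·u₂^{i−1}` — through this
lineage's generator reduction.  (`i = 1`: abc-iut-L2-t6's Tate instance; `i = 2`: p501580.) [cite: MochizukiEtTh2009, Prop 1.5 (iii) p.23] -/
theorem prop15iii_etaDdTwistPow_line (hC : (ThetaSetting.modelχq p i 2 even_two).Compat) :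
    ThetaSetting.Prop15iii
      (((kummerCoreχq p i 2 even_two).toKummerDataOfSection s hs hsec hsY hsYdd).etaleThetaDataOfClass
        (etaDdχq p i 2 even_two *
          (ThetaSetting.modelχq p i 2 even_two).inflTheta (ThetaSetting.modelχq p i 2 even_two).GtpYdd
            (kummerCoreχq p i 2 even_two).logUdd ^ (i - 1))) hC := by
  haveI := hC.GtpYddTheta_normal
  have e := kumYdd_toKddHat_ofSection_modelχq p i 2 even_two s hs hsec hsY hsYdd
  refine (kummerCoreχq p i 2 even_two).prop15iii_etaleThetaDataOfClass_ofSection_of_generator s hs hsec hsY hsYdd hC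
    _ (zClassYddχq p i 2 even_two * (kummerCoreχq p i 2 even_two).logUdd ^ (i - 1)) ?_ ?_
    (toZ_inl_gfpOf_a p i 2 even_two) ?_ (unitLaw_GtpY_logUdd p i 2 even_two hC s hs hsec hsY hsYdd) ?_ ?_
  · -- `infl(x_{i−1}) = η_{i−1}`
    rw [map_mul, map_zpow, etaDdχq_def]
  · -- `res(x_{i−1}) = log(Θ)`
    refine ((ContH1.res _ _ _).map_mul _ _).trans ?_
    refine (congrArg₂ (· * ·) (res_zClassYddχq_eq_logTheta p i 2 even_two hC)
      (map_zpow (ContH1.res (MonoidHom.id _) _ _) _ _)).trans ?_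
    rw [res_deltaTheta_logUdd_kummerCoreχq p i 2 even_two s hs hsec hsY hsYdd hC, one_zpow, mul_one]
  · -- `hL₀`
    refine ⟨1, (ThetaSetting.modelχq p i 2 even_two).unitsOKdd.one_mem, ?_⟩
    rw [e, e]
    exact conj_deckGen_logUdd p i hC
  · -- `hx₀`: the twisted display at `n = 1`, `m = i − 1`
    refine ⟨1, (ThetaSetting.modelχq p i 2 even_two).unitsOKdd.one_mem, ?_⟩
    have h := conj_toTheta_zpow_deckGen_twistLift p i hC 1 (i - 1)
    rw [zpow_one, show -(2 * (1 : ℤ)) = -2 by norm_num,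
      show -((1 : ℤ) * (1 - 1) + 1 * i - 1 * (i - 1)) = -1 by ring] at h
    rw [e, e, map_one, map_one, mul_one]
    exact h
  · -- `hxY`: unit-moves of `x_{i−1}` under `Π^tp_Y`
    intro y hy
    obtain ⟨u₁, hu₁, h₁⟩ := unitLaw_GtpY_zClassYddχq p i 2 even_two hC s hs hsec hsY hsYdd y hy
    obtain ⟨u₂, hu₂, h₂⟩ := unitLaw_GtpY_logUdd p i 2 even_two hC s hs hsec hsY hsYdd y hy
    refine ⟨u₁ * u₂ ^ (i - 1), (ThetaSetting.modelχq p i 2 even_two).unitsOKdd.mul_mem hu₁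
      ((ThetaSetting.modelχq p i 2 even_two).unitsOKdd.zpow_mem hu₂ _), ?_⟩
    rw [map_mul, map_zpow, h₁, h₂, map_mul, map_mul, map_zpow, map_zpow]
    exact twistPow_unit_algebra _ _ _ _ (i - 1)

/-- **`Prop15iii(η_m) ⇒ m = i − 1` at `modelχq p i 2`** (every `i`, every `m`, every section `s`): the unique lift of `η_m` is
`x_m = x′·log(Ü)^m` (`inflTheta_injective`); its typed display at `σ₀` (exponents `−2`, `−1`, a unit `u`) against file (A)'s
`σ₀·x_m = x_m·log(Ü)^{−2}·κ̈(q̈)^{−(i − m)}` gives `κ̈(q̈)^{m − i + 1} = κ̈(u)`, so `q̈^{m − i + 1} ∈ O^×_K̈`, i.e. `m = i − 1`.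
[cite: MochizukiEtTh2009, Prop 1.5 (iii) p.23] -/
theorem twistPow_eq_of_prop15iii_line (hC : (ThetaSetting.modelχq p i 2 even_two).Compat) (m : ℤ)
    (h15 : ThetaSetting.Prop15iii
      (((kummerCoreχq p i 2 even_two).toKummerDataOfSection s hs hsec hsY hsYdd).etaleThetaDataOfClass
        (etaDdχq p i 2 even_two *
          (ThetaSetting.modelχq p i 2 even_two).inflTheta (ThetaSetting.modelχq p i 2 even_two).GtpYdd
            (kummerCoreχq p i 2 even_two).logUdd ^ m)) hC) :
    m = i - 1 := by
  haveI := hC.GtpYddTheta_normal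
  have hη : etaDdχq p i 2 even_two *
        (ThetaSetting.modelχq p i 2 even_two).inflTheta (ThetaSetting.modelχq p i 2 even_two).GtpYdd
          (kummerCoreχq p i 2 even_two).logUdd ^ m ∈
      (((kummerCoreχq p i 2 even_two).toKummerDataOfSection s hs hsec hsY hsYdd).etaleThetaDataOfClass
        (etaDdχq p i 2 even_two *
          (ThetaSetting.modelχq p i 2 even_two).inflTheta (ThetaSetting.modelχq p i 2 even_two).GtpYdd
            (kummerCoreχq p i 2 even_two).logUdd ^ m)).thetaClasses :=
    ⟨1, one_mem _, by rw [one_mul]; rfl⟩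
  obtain ⟨x', ⟨hx', -, hlaw⟩, -⟩ := h15 _ hη
  have hxz : x' = zClassYddχq p i 2 even_two * (kummerCoreχq p i 2 even_two).logUdd ^ m :=
    (ThetaSetting.modelχq p i 2 even_two).inflTheta_injective _
      (hx'.trans (by rw [map_mul, map_zpow, etaDdχq_def]))
  subst hxz
  obtain ⟨u, hu, hdisp⟩ := hlaw (SemidirectProduct.inl (gfpOf (FreeGroup.of 0)))
  rw [toZ_inl_gfpOf_a, toAdd_ofAdd, mul_one, mul_one] at hdisp
  -- the section datum's unit classes are the core's; `log(Ü)` of the datum is the core's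
  change ContH1.conj _ _ _ (zClassYddχq p i 2 even_two * (kummerCoreχq p i 2 even_two).logUdd ^ m) =
    zClassYddχq p i 2 even_two * (kummerCoreχq p i 2 even_two).logUdd ^ m *
      (kummerCoreχq p i 2 even_two).logUdd ^ (-(2 : ℤ)) *
      ((kummerCoreχq p i 2 even_two).toKummerDataOfSection s hs hsec hsY hsYdd).kumYdd
        (((kummerCoreχq p i 2 even_two).toKummerDataOfSection s hs hsec hsY hsYdd).toKddHat
          (ThetaSetting.modelχq p i 2 even_two).qddUnit) ^ (-(1 : ℤ)) *
      ((kummerCoreχq p i 2 even_two).toKummerDataOfSection s hs hsec hsY hsYdd).kumYdd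
        (((kummerCoreχq p i 2 even_two).toKummerDataOfSection s hs hsec hsY hsYdd).toKddHat u) at hdisp
  have hmod := conj_toTheta_zpow_deckGen_twistLift p i hC 1 m
  rw [zpow_one, show -(2 * (1 : ℤ)) = -2 by norm_num, show -((1 : ℤ) * (1 - 1) + 1 * i - 1 * m) = -(i - m) by ring] at hmod
  rw [kumYdd_toKddHat_ofSection_modelχq, kumYdd_toKddHat_ofSection_modelχq, hmod, mul_assoc (_ * _ ^ (-(2 : ℤ)))] at hdisp
  have h' := mul_left_cancel hdisp
  -- `κ̈(q̈)^{−(i−m)} = κ̈(q̈)^{−1} · κ̈(u)`, so `q̈^{m − i + 1} = u`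
  rw [← map_zpow, ← map_zpow, ← map_zpow, ← map_zpow, ← map_mul, ← map_mul] at h'
  have heq : (ThetaSetting.modelχq p i 2 even_two).qddUnit ^ (-(i - m)) =
      (ThetaSetting.modelχq p i 2 even_two).qddUnit ^ (-(1 : ℤ)) * u :=
    (kummerCoreχq p i 2 even_two).toKummerData.toKddHat_injective
      ((kummerCoreχq p i 2 even_two).toKummerData.kumYdd_injective h')
  have hmem : (ThetaSetting.modelχq p i 2 even_two).qddUnit ^ (m - i + 1) ∈ (ThetaSetting.modelχq p i 2 even_two).unitsOKdd := by
    have e : (ThetaSetting.modelχq p i 2 even_two).qddUnit ^ (m - i + 1) = u := by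
      rw [show m - i + 1 = (1 : ℤ) + (-(i - m)) by ring, zpow_add, heq, ← mul_assoc, ← zpow_add, add_neg_cancel,
        zpow_zero, one_mul]
    rw [e]
    exact hu
  have h0 := ((ThetaSetting.modelχq p i 2 even_two).qddUnit_zpow_mem_unitsOKdd_iff _).mp hmem
  omega

/-- **On the line: `Prop15iii(η_m) ↔ m = i − 1` at `modelχq p i 2`** (every `i`, `m`, `s`). [cite: MochizukiEtTh2009, Prop 1.5 (iii) p.23] -/
theorem prop15iii_etaDdTwistPow_line_iff (hC : (ThetaSetting.modelχq p i 2 even_two).Compat) (m : ℤ) :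
    ThetaSetting.Prop15iii
        (((kummerCoreχq p i 2 even_two).toKummerDataOfSection s hs hsec hsY hsYdd).etaleThetaDataOfClass
          (etaDdχq p i 2 even_two *
            (ThetaSetting.modelχq p i 2 even_two).inflTheta (ThetaSetting.modelχq p i 2 even_two).GtpYdd
              (kummerCoreχq p i 2 even_two).logUdd ^ m)) hC ↔ m = i - 1 := by
  refine ⟨twistPow_eq_of_prop15iii_line p i s hs hsec hsY hsYdd hC m, ?_⟩
  rintro rfl
  exact prop15iii_etaDdTwistPow_line p i s hs hsec hsY hsYdd hC

end LineTwo

section OfSection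

variable (s : GQp p →* (ThetaSetting.modelχq p i j hj).PiTemp) (hs : Continuous s)
  (hsec : ∀ σ : GQp p, (ThetaSetting.modelχq p i j hj).aug (s σ) = σ)
  (hsY : (ThetaSetting.modelχq p i j hj).GK.map s ≤ (ThetaSetting.modelχq p i j hj).GtpY)
  (hsYdd : (ThetaSetting.modelχq p i j hj).GKdd.map s ≤ (ThetaSetting.modelχq p i j hj).GtpYdd)

/-- **THE PINNING OF THE TWIST FAMILY**: at `modelχq p i j` (every `p`, `i`, even `j`, `m ∈ ℤ`, every Galois section `s`, every
`Compat` witness) the typed Prop. 1.5 (iii) for the étale-theta datum of `η_m = η̈♯ · infl(log Ü)^m` over the section Kummer datum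
holds IFF `j = 2 ∧ m = i − 1` — the shear exponent is pinned by this seat's gen-6 `not_prop15iii_modelχq_of_ne_two` (every class),
the twist exponent by the display at `σ₀`.  Generalises `prop15iii_etaDdχq_iff` (`m = 0 ↔ (i, j) = (1, 2)`) and p501580 (`(2, 2, 1)`).
[cite: MochizukiEtTh2009, Prop 1.5 (iii) p.23] -/
theorem prop15iii_etaDdTwistPow_iff (hC : (ThetaSetting.modelχq p i j hj).Compat) (m : ℤ) :
    ThetaSetting.Prop15iii
        (((kummerCoreχq p i j hj).toKummerDataOfSection s hs hsec hsY hsYdd).etaleThetaDataOfClass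
          (etaDdχq p i j hj *
            (ThetaSetting.modelχq p i j hj).inflTheta (ThetaSetting.modelχq p i j hj).GtpYdd
              (kummerCoreχq p i j hj).logUdd ^ m)) hC ↔ j = 2 ∧ m = i - 1 := by
  constructor
  · intro h15
    have hj2 : j = 2 := by
      by_contra hne
      exact not_prop15iii_modelχq_of_ne_two p i j hj s hs hsec hsY hsYdd hne hC _ h15
    subst hj2
    exact ⟨rfl, twistPow_eq_of_prop15iii_line p i s hs hsec hsY hsYdd hC m h15⟩
  · rintro ⟨rfl, rfl⟩
    exact prop15iii_etaDdTwistPow_line p i s hs hsec hsY hsYdd hC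

/-- **Some member of the twist family satisfies the typed Prop. 1.5 (iii) at `modelχq p i j` iff `j = 2`** (then exactly
`m = i − 1`). [cite: MochizukiEtTh2009, Prop 1.5 (iii) p.23] -/
theorem exists_twistPow_prop15iii_iff (hC : (ThetaSetting.modelχq p i j hj).Compat) :
    (∃ m : ℤ, ThetaSetting.Prop15iii
        (((kummerCoreχq p i j hj).toKummerDataOfSection s hs hsec hsY hsYdd).etaleThetaDataOfClass
          (etaDdχq p i j hj *
            (ThetaSetting.modelχq p i j hj).inflTheta (ThetaSetting.modelχq p i j hj).GtpYdd
              (kummerCoreχq p i j hj).logUdd ^ m)) hC) ↔ j = 2 := by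
  constructor
  · rintro ⟨m, h15⟩
    exact ((prop15iii_etaDdTwistPow_iff p i j hj s hs hsec hsY hsYdd hC m).mp h15).1
  · intro hj2
    exact ⟨i - 1, (prop15iii_etaDdTwistPow_iff p i j hj s hs hsec hsY hsYdd hC (i - 1)).mpr ⟨hj2, rfl⟩⟩

end OfSection

/-- **Root-level census form of the pinning** (the `inr`-section): within the stage-2 family and the twist family, the pairs
(`modelχq p i j`, `η_m`) whose `inr`-section datum satisfies the typed Prop. 1.5 (iii) are EXACTLY those with `j = 2`, `m = i − 1`.
[cite: MochizukiEtTh2009, Prop 1.5 (iii) p.23] -/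
theorem prop15iii_etaDdTwistPow_inr_iff (hC : (ThetaSetting.modelχq p i j hj).Compat) (m : ℤ) :
    ThetaSetting.Prop15iii
        (((kummerCoreχq p i j hj).toKummerDataOfSection SemidirectProduct.inr (continuous_inrχq p i j)
          (fun _ => rfl) (map_inr_GK_le_GtpY_modelχq' p i j hj) (map_inr_GKdd_le_GtpYdd_modelχq' p i j hj)).etaleThetaDataOfClass
          (etaDdχq p i j hj *
            (ThetaSetting.modelχq p i j hj).inflTheta (ThetaSetting.modelχq p i j hj).GtpYdd
              (kummerCoreχq p i j hj).logUdd ^ m)) hC ↔ j = 2 ∧ m = i - 1 :=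
  prop15iii_etaDdTwistPow_iff p i j hj _ _ _ _ _ hC m

end Literature.AnabelianGeometry.EtaleTheta.SettingModel

end
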